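import Summits.HubbardSuperconductivity.HubbardSuperconductivity.Theorems.WeakCouplingBCSKlLindhardEnclosureCeilStructuralInRoot

/-!
# KL-MARGIN-SCAN reader (22) «kernel-lindhard-enclosure» — ceiling soundness RESTRICTED TO THE ROOT SQUARE, part 2/2: the five restricted rule predicates

Part 2 of the restricted ceiling reduction (see part 1 `…CeilStructuralInRoot` for why the restriction to admissible `P` and cells inside the
root square `[−Xz, Xz]²` is the right discharge target): the five RULE-level predicates `SameSideZeroIn`, `CeilCrudeSoundIn`, `CeilChordSoundIn`,
`CeilBdrySoundIn`, `CeilTipSoundIn` (each: admissible `P`, one guarded grid cell inside the root square, the rule's own certified outcome ⇒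
`CeilValid`), the case analysis of the fused leaf `leafCeilSoundIn_of_rules`, and `ceilSoundAt_of_rulesIn : … → ∀ t, CeilSoundAt P t`.
Honest framing: reductions only — the five rule predicates are NOT proved here; floats are floats; nothing in this file asserts a KL margin at
any `t′ ≠ 0`, `K₃`, `U₀`, the window or B1g dominance; a Kohn–Luttinger instability statement is not ODLRO and nothing here proves
superconductivity in the Hubbard model.  (p1 g25, 2026-08-29.)
-/

noncomputable section

set_option linter.dupNamespace false

namespace Summit.HubbardSuperconductivity.HubbardSuperconductivity.Theorems.KlLindhardEnclosure

open Real Set MeasureTheory Literature.MathematicalPhysics.QuantumLattice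
open Summit.HubbardSuperconductivity.HubbardSuperconductivity.Theorems

/-! ## §2 The five ceiling rules, restricted to admissible `P` and cells inside the root square -/

/-- **SAME-SIDE RULE (restricted)**: admissible `P`, guarded cell inside the root square, both statuses certified EQUAL ⇒ no mass. [folklore] -/
def SameSideZeroIn (P : Params) : Prop :=
  ∀ (a b c d : ℤ) (k : Bool), P.admissible = true → P.InRoot a b c d →
    (P.cell (P.mkX a) (P.mkX b) (P.mkY c) (P.mkY d)).guards = true →
    P.status (P.cell (P.mkX a) (P.mkX b) (P.mkY c) (P.mkY d)).e1Lo (P.cell (P.mkX a) (P.mkX b) (P.mkY c) (P.mkY d)).e1Hi = some k →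
    P.status (P.cell (P.mkX a) (P.mkX b) (P.mkY c) (P.mkY d)).e2Lo (P.cell (P.mkX a) (P.mkX b) (P.mkY c) (P.mkY d)).e2Hi = some k →
      P.CeilValid a b c d 0

/-- **CRUDE-CEILING RULE (restricted)**: admissible `P`, guarded cell inside the root square, `ceilCrude = some v` ⇒ certified. [folklore] -/
def CeilCrudeSoundIn (P : Params) : Prop :=
  ∀ (a b c d v : ℤ), P.admissible = true → P.InRoot a b c d →
    (P.cell (P.mkX a) (P.mkX b) (P.mkY c) (P.mkY d)).guards = true →
    P.ceilCrude (P.cell (P.mkX a) (P.mkX b) (P.mkY c) (P.mkY d)) (P.mkX a) (P.mkX b) (P.mkY c) (P.mkY d) = some v →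
      P.CeilValid a b c d v

/-- **CHORD-CEILING RULE (restricted)**: admissible `P`, guarded two-shell cell of kind `k` inside the root square, `ceilChord = some u` ⇒
certified. [folklore] -/
def CeilChordSoundIn (P : Params) : Prop :=
  ∀ (a b c d : ℤ) (k : Bool) (u : ℤ), P.admissible = true → P.InRoot a b c d →
    (P.cell (P.mkX a) (P.mkX b) (P.mkY c) (P.mkY d)).guards = true →
    P.status (P.cell (P.mkX a) (P.mkX b) (P.mkY c) (P.mkY d)).e1Lo (P.cell (P.mkX a) (P.mkX b) (P.mkY c) (P.mkY d)).e1Hi = some k →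
    P.status (P.cell (P.mkX a) (P.mkX b) (P.mkY c) (P.mkY d)).e2Lo (P.cell (P.mkX a) (P.mkX b) (P.mkY c) (P.mkY d)).e2Hi = some (!k) →
    P.ceilChord (P.cell (P.mkX a) (P.mkX b) (P.mkY c) (P.mkY d)) k (P.mkX a) (P.mkX b) (P.mkY c) (P.mkY d) = some u →
      P.CeilValid a b c d u

/-- **MAJORISED-HYPERBOLA RULE (restricted)**: admissible `P`, guarded single-straddle cell inside the root square (`sh`, `far` as in
`CeilBdrySoundAt`), every hint payload: `ceilBdry … sh (!far) τx τy = some u` ⇒ certified. [folklore] -/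
def CeilBdrySoundIn (P : Params) : Prop :=
  ∀ (a b c d : ℤ) (sh far : Bool) (τx τy : ℕ) (u : ℤ), P.admissible = true → P.InRoot a b c d →
    (P.cell (P.mkX a) (P.mkX b) (P.mkY c) (P.mkY d)).guards = true →
    P.status (P.cell (P.mkX a) (P.mkX b) (P.mkY c) (P.mkY d)).e1Lo (P.cell (P.mkX a) (P.mkX b) (P.mkY c) (P.mkY d)).e1Hi = (if sh then some far else none) →
    P.status (P.cell (P.mkX a) (P.mkX b) (P.mkY c) (P.mkY d)).e2Lo (P.cell (P.mkX a) (P.mkX b) (P.mkY c) (P.mkY d)).e2Hi = (if sh then none else some far) →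
    P.ceilBdry (P.cell (P.mkX a) (P.mkX b) (P.mkY c) (P.mkY d)) sh (!far) τx τy (P.mkX a) (P.mkX b) (P.mkY c) (P.mkY d) = some u →
      P.CeilValid a b c d u

/-- **TIP RULE (restricted)**: admissible `P`, guarded doubly-straddling cell inside the root square, every 8-hint payload:
`ceilTip … = some u` ⇒ certified. [folklore] -/
def CeilTipSoundIn (P : Params) : Prop :=
  ∀ (a b c d : ℤ) (τx σx τy σy τx' σx' τy' σy' : ℕ) (u : ℤ), P.admissible = true → P.InRoot a b c d →
    (P.cell (P.mkX a) (P.mkX b) (P.mkY c) (P.mkY d)).guards = true →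
    P.status (P.cell (P.mkX a) (P.mkX b) (P.mkY c) (P.mkY d)).e1Lo (P.cell (P.mkX a) (P.mkX b) (P.mkY c) (P.mkY d)).e1Hi = none →
    P.status (P.cell (P.mkX a) (P.mkX b) (P.mkY c) (P.mkY d)).e2Lo (P.cell (P.mkX a) (P.mkX b) (P.mkY c) (P.mkY d)).e2Hi = none →
    P.ceilTip (P.cell (P.mkX a) (P.mkX b) (P.mkY c) (P.mkY d)) τx σx τy σy τx' σx' τy' σy' (P.mkX a) (P.mkX b) (P.mkY c) (P.mkY d) = some u →
      P.CeilValid a b c d u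

/-- **THE RESTRICTED PER-LEAF CEILING DEBT IS THE FIVE RESTRICTED RULES.** -/
theorem leafCeilSoundIn_of_rules (P : Params) (hSS : SameSideZeroIn P) (hCr : CeilCrudeSoundIn P) (hCh : CeilChordSoundIn P)
    (hB : CeilBdrySoundIn P) (hT : CeilTipSoundIn P) : LeafCeilSoundIn P := by
  intro bd tp a b c d N hP hin h
  set x0 := P.mkX a with hx0
  set x1 := P.mkX b with hx1
  set y0 := P.mkY c with hy0
  set y1 := P.mkY d with hy1
  by_cases hg : (P.cell x0 x1 y0 y1).guards = true
  · rcases hs1 : P.status (P.cell x0 x1 y0 y1).e1Lo (P.cell x0 x1 y0 y1).e1Hi with _ | ⟨_ | _⟩ <;>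
      rcases hs2 : P.status (P.cell x0 x1 y0 y1).e2Lo (P.cell x0 x1 y0 y1).e2Hi with _ | ⟨_ | _⟩
    · -- none, none : tip cell
      rcases tp with _ | ⟨τx, σx, τy, σy, τx', σx', τy', σy'⟩
      · simp only [Params.leaf, hg, hs1, hs2, Bool.not_true, Bool.false_eq_true, ↓reduceIte] at h
        split at h
        · rename_i u v hu hv
          simp only [Option.some.injEq] at h
          have hN : N = min u v := by omega
          subst hN
          exact P.ceilValid_min (hT a b c d _ _ _ _ _ _ _ _ u hP hin hg hs1 hs2 hu) (hCr a b c d v hP hin hg hv)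
        · rename_i u hu hv
          simp only [Option.some.injEq] at h
          have hN : N = u := by omega
          subst hN
          exact hT a b c d _ _ _ _ _ _ _ _ _ hP hin hg hs1 hs2 hu
        · rename_i v hu hv
          simp only [Option.some.injEq] at h
          have hN : N = v := by omega
          subst hN
          exact hCr a b c d _ hP hin hg hv
        · simp at h
      · simp only [Params.leaf, hg, hs1, hs2, Bool.not_true, Bool.false_eq_true, ↓reduceIte] at h
        split at h
        · rename_i u v hu hv
          simp only [Option.some.injEq] at h
          have hN : N = min u v := by omega
          subst hN
          exact P.ceilValid_min (hT a b c d _ _ _ _ _ _ _ _ u hP hin hg hs1 hs2 hu) (hCr a b c d v hP hin hg hv)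
        · rename_i u hu hv
          simp only [Option.some.injEq] at h
          have hN : N = u := by omega
          subst hN
          exact hT a b c d _ _ _ _ _ _ _ _ _ hP hin hg hs1 hs2 hu
        · rename_i v hu hv
          simp only [Option.some.injEq] at h
          have hN : N = v := by omega
          subst hN
          exact hCr a b c d _ hP hin hg hv
        · simp at h
    · -- none, some false
      rcases bd with _ | ⟨σx, σy, τx, τy⟩
      · simp only [Params.leaf, hg, hs1, hs2, Bool.not_true, Bool.not_false, Bool.false_eq_true, ↓reduceIte] at h
        split at h
        · rename_i u v hu hv
          simp only [Option.some.injEq] at h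
          have hN : N = min u v := by omega
          subst hN
          exact P.ceilValid_min (hB a b c d false false _ _ u hP hin hg (by simpa using hs1) (by simpa using hs2) hu) (hCr a b c d v hP hin hg hv)
        · rename_i u hu hv
          simp only [Option.some.injEq] at h
          have hN : N = u := by omega
          subst hN
          exact hB a b c d false false _ _ _ hP hin hg (by simpa using hs1) (by simpa using hs2) hu
        · rename_i v hu hv
          simp only [Option.some.injEq] at h
          have hN : N = v := by omega
          subst hN
          exact hCr a b c d _ hP hin hg hv
        · simp at h
      · simp only [Params.leaf, hg, hs1, hs2, Bool.not_true, Bool.not_false, Bool.false_eq_true, ↓reduceIte] at h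
        split at h
        · rename_i u v hu hv
          simp only [Option.some.injEq] at h
          have hN : N = min u v := by omega
          subst hN
          exact P.ceilValid_min (hB a b c d false false _ _ u hP hin hg (by simpa using hs1) (by simpa using hs2) hu) (hCr a b c d v hP hin hg hv)
        · rename_i u hu hv
          simp only [Option.some.injEq] at h
          have hN : N = u := by omega
          subst hN
          exact hB a b c d false false _ _ _ hP hin hg (by simpa using hs1) (by simpa using hs2) hu
        · rename_i v hu hv
          simp only [Option.some.injEq] at h
          have hN : N = v := by omega
          subst hN
          exact hCr a b c d _ hP hin hg hv
        · simp at h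
    · -- none, some true
      rcases bd with _ | ⟨σx, σy, τx, τy⟩
      · simp only [Params.leaf, hg, hs1, hs2, Bool.not_true, Bool.false_eq_true, ↓reduceIte] at h
        split at h
        · rename_i u v hu hv
          simp only [Option.some.injEq] at h
          have hN : N = min u v := by omega
          subst hN
          exact P.ceilValid_min (hB a b c d false true _ _ u hP hin hg (by simpa using hs1) (by simpa using hs2) hu) (hCr a b c d v hP hin hg hv)
        · rename_i u hu hv
          simp only [Option.some.injEq] at h
          have hN : N = u := by omega
          subst hN
          exact hB a b c d false true _ _ _ hP hin hg (by simpa using hs1) (by simpa using hs2) hu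
        · rename_i v hu hv
          simp only [Option.some.injEq] at h
          have hN : N = v := by omega
          subst hN
          exact hCr a b c d _ hP hin hg hv
        · simp at h
      · simp only [Params.leaf, hg, hs1, hs2, Bool.not_true, Bool.false_eq_true, ↓reduceIte] at h
        split at h
        · rename_i u v hu hv
          simp only [Option.some.injEq] at h
          have hN : N = min u v := by omega
          subst hN
          exact P.ceilValid_min (hB a b c d false true _ _ u hP hin hg (by simpa using hs1) (by simpa using hs2) hu) (hCr a b c d v hP hin hg hv)
        · rename_i u hu hv
          simp only [Option.some.injEq] at h
          have hN : N = u := by omega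
          subst hN
          exact hB a b c d false true _ _ _ hP hin hg (by simpa using hs1) (by simpa using hs2) hu
        · rename_i v hu hv
          simp only [Option.some.injEq] at h
          have hN : N = v := by omega
          subst hN
          exact hCr a b c d _ hP hin hg hv
        · simp at h
    · -- some false, none
      rcases bd with _ | ⟨σx, σy, τx, τy⟩
      · simp only [Params.leaf, hg, hs1, hs2, Bool.not_true, Bool.not_false, Bool.false_eq_true, ↓reduceIte] at h
        split at h
        · rename_i u v hu hv
          simp only [Option.some.injEq] at h
          have hN : N = min u v := by omega
          subst hN
          exact P.ceilValid_min (hB a b c d true false _ _ u hP hin hg (by simpa using hs1) (by simpa using hs2) hu) (hCr a b c d v hP hin hg hv)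
        · rename_i u hu hv
          simp only [Option.some.injEq] at h
          have hN : N = u := by omega
          subst hN
          exact hB a b c d true false _ _ _ hP hin hg (by simpa using hs1) (by simpa using hs2) hu
        · rename_i v hu hv
          simp only [Option.some.injEq] at h
          have hN : N = v := by omega
          subst hN
          exact hCr a b c d _ hP hin hg hv
        · simp at h
      · simp only [Params.leaf, hg, hs1, hs2, Bool.not_true, Bool.not_false, Bool.false_eq_true, ↓reduceIte] at h
        split at h
        · rename_i u v hu hv
          simp only [Option.some.injEq] at h
          have hN : N = min u v := by omega
          subst hN
          exact P.ceilValid_min (hB a b c d true false _ _ u hP hin hg (by simpa using hs1) (by simpa using hs2) hu) (hCr a b c d v hP hin hg hv)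
        · rename_i u hu hv
          simp only [Option.some.injEq] at h
          have hN : N = u := by omega
          subst hN
          exact hB a b c d true false _ _ _ hP hin hg (by simpa using hs1) (by simpa using hs2) hu
        · rename_i v hu hv
          simp only [Option.some.injEq] at h
          have hN : N = v := by omega
          subst hN
          exact hCr a b c d _ hP hin hg hv
        · simp at h
    · -- some false, some false : same side
      simp only [Params.leaf, hg, hs1, hs2, Bool.not_true, Bool.false_eq_true, ↓reduceIte] at h
      simp only [Option.some.injEq] at h
      have hN : N = 0 := by omega
      subst hN
      exact hSS a b c d false hP hin hg hs1 hs2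
    · -- some false, some true : two-shell kind II
      simp only [Params.leaf, hg, hs1, hs2, Bool.not_true, Bool.false_eq_true, ↓reduceIte] at h
      split at h
      · rename_i u v hu hv
        simp only [Option.some.injEq] at h
        have hN : N = min u v := by omega
        subst hN
        exact P.ceilValid_min (hCh a b c d false u hP hin hg hs1 hs2 hu) (hCr a b c d v hP hin hg hv)
      · rename_i u hu hv
        simp only [Option.some.injEq] at h
        have hN : N = u := by omega
        subst hN
        exact hCh a b c d false _ hP hin hg hs1 hs2 hu
      · rename_i v hu hv
        simp only [Option.some.injEq] at h
        have hN : N = v := by omega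
        subst hN
        exact hCr a b c d _ hP hin hg hv
      · simp at h
    · -- some true, none
      rcases bd with _ | ⟨σx, σy, τx, τy⟩
      · simp only [Params.leaf, hg, hs1, hs2, Bool.not_true, Bool.false_eq_true, ↓reduceIte] at h
        split at h
        · rename_i u v hu hv
          simp only [Option.some.injEq] at h
          have hN : N = min u v := by omega
          subst hN
          exact P.ceilValid_min (hB a b c d true true _ _ u hP hin hg (by simpa using hs1) (by simpa using hs2) hu) (hCr a b c d v hP hin hg hv)
        · rename_i u hu hv
          simp only [Option.some.injEq] at h
          have hN : N = u := by omega
          subst hN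
          exact hB a b c d true true _ _ _ hP hin hg (by simpa using hs1) (by simpa using hs2) hu
        · rename_i v hu hv
          simp only [Option.some.injEq] at h
          have hN : N = v := by omega
          subst hN
          exact hCr a b c d _ hP hin hg hv
        · simp at h
      · simp only [Params.leaf, hg, hs1, hs2, Bool.not_true, Bool.false_eq_true, ↓reduceIte] at h
        split at h
        · rename_i u v hu hv
          simp only [Option.some.injEq] at h
          have hN : N = min u v := by omega
          subst hN
          exact P.ceilValid_min (hB a b c d true true _ _ u hP hin hg (by simpa using hs1) (by simpa using hs2) hu) (hCr a b c d v hP hin hg hv)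
        · rename_i u hu hv
          simp only [Option.some.injEq] at h
          have hN : N = u := by omega
          subst hN
          exact hB a b c d true true _ _ _ hP hin hg (by simpa using hs1) (by simpa using hs2) hu
        · rename_i v hu hv
          simp only [Option.some.injEq] at h
          have hN : N = v := by omega
          subst hN
          exact hCr a b c d _ hP hin hg hv
        · simp at h
    · -- some true, some false : two-shell kind I
      simp only [Params.leaf, hg, hs1, hs2, Bool.not_true, Bool.false_eq_true, ↓reduceIte] at h
      split at h
      · rename_i u v hu hv
        simp only [Option.some.injEq] at h
        have hN : N = min u v := by omega
        subst hN
        exact P.ceilValid_min (hCh a b c d true u hP hin hg hs1 hs2 hu) (hCr a b c d v hP hin hg hv)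
      · rename_i u hu hv
        simp only [Option.some.injEq] at h
        have hN : N = u := by omega
        subst hN
        exact hCh a b c d true _ hP hin hg hs1 hs2 hu
      · rename_i v hu hv
        simp only [Option.some.injEq] at h
        have hN : N = v := by omega
        subst hN
        exact hCr a b c d _ hP hin hg hv
      · simp at h
    · -- some true, some true : same side
      simp only [Params.leaf, hg, hs1, hs2, Bool.not_true, Bool.false_eq_true, ↓reduceIte] at h
      simp only [Option.some.injEq] at h
      have hN : N = 0 := by omega
      subst hN
      exact hSS a b c d true hP hin hg hs1 hs2
  · -- failed guards
    have hg' : (P.cell x0 x1 y0 y1).guards = false := by simpa using hg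
    simp [Params.leaf, hg'] at h

/-- **CEILING SOUNDNESS FROM THE FIVE RESTRICTED RULES, for every certificate tree** — the discharge route of record. -/
theorem ceilSoundAt_of_rulesIn (P : Params) (hSS : SameSideZeroIn P) (hCr : CeilCrudeSoundIn P) (hCh : CeilChordSoundIn P)
    (hB : CeilBdrySoundIn P) (hT : CeilTipSoundIn P) (t : QB) : CeilSoundAt P t :=
  ceilSoundAt_of_leafCeilSoundIn P (leafCeilSoundIn_of_rules P hSS hCr hCh hB hT) t

end Summit.HubbardSuperconductivity.HubbardSuperconductivity.Theorems.KlLindhardEnclosure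

end
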